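import Summits.QuantumFields.YangMills.Theorems.BalabanUVNodesN14BinderKeyCoarsening

/-!
# DAG node N14 (NE1′) — THE FIBRE-OSCILLATION LETTER OF FILE 7 IN THE DECOUPLED CARICATURE: exact decoupling ⇒ `ω = 0`; one decoupled slot of amplitude `a` ⇒ `ω ≤ 2a`
# (`≤ 2a²·l₀` when centred) — NE1′'s own `TiltedMeanInfluence` calculus BY NAME, in the family shape FILE 7's `tiltedMeanMatching_push_of_fibreOsc` consumes

Cell `pub-ymgap` (HUMAN RULING D-0062, Track A), WIDTH SEAT `pub-ymgap-dag-n14-w2` (NODE n14 = NE1′), generation 6, FILE 8; `--kind proof --supports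
stmt-QuantumFields-20544 --as helper` (K3⁷; helper, NOT a discharge; count-neutral).  THEOREMS ONLY (0 `def`, 0 `instance`, 0 `sorry`).  Imports this seat's FILE 7
`…N14BinderKeyCoarsening` (p620796; through it FILE 1 and NE1′'s `Spine/NE1p/TiltedMeanInfluence`: `tiltedMean_prod_add`, `influence_eq`, `abs_influence_le`,
`abs_influence_le_of_centred` — CITED BY NAME; edits nothing).

WHY.  FILE 7 priced the descent of N14's binder to a coarser key (v6's window key) by the ONE-RUN fibre oscillation `ω_K`: for two fine classes `τ, τ′` of one coarse class,
`|tiltedMean (F K) (ν K τ) s − tiltedMean (F K) (ν K τ′) s| ≤ ω_K` on the tilt window.  In the application the fine classes of a window class differ only in OLD large-field data,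
far from the loop.  This file records what NE1′'s decoupling calculus already gives for that letter, in the family shape FILE 7 consumes:
* ★ `fibreOsc_zero_of_decoupled` — EXACT DECOUPLING: if on a fibre every class piece is a product `ρ ⊗ κ_τ` of ONE observable-region law `ρ` with a class-dependent
  old-region law `κ_τ ≠ 0`, and the observable reads the first factor only, the class-wise tilted means are EQUAL across the fibre (`ω = 0`; `tiltedMean_prod_fst`).
* ★ `fibreOsc_le_of_slot` — ONE DECOUPLED SLOT: if the observable also carries a slot contribution `h` of amplitude `a` living on the old-region factor, the oscillation over the
  fibre is `≤ 2a` (NE1′'s `abs_influence_le`), and ★ `fibreOsc_le_of_slot_centred` — `≤ 2a²·l₀` on `|s| ≤ l₀` when every `κ_τ` centres `h` (NE1′'s `abs_influence_le_of_centred`: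
  second order, the mechanism of `Spine/NE1p/TiltedMeanInfluence` §3).
So in the caricature the descent price of FILE 7 is an NE1′-internal decoupling quantity with kernel producers; for Bałaban's class-conditioned laws (not products) the producer is
NODE O's cluster-expansion object — not here.

HONEST FRAMING.  [folklore] product-measure bookkeeping BY NAME on hypothesis SHAPES (product structure of the class pieces is a CARICATURE hypothesis, not a property of
Bałaban's densities); proves NO estimate of the programme; nothing of Bałaban's asserted or instantiated; NE1′ ∕ NE7 NOT PRINTED as two-run statements for d = 4, NOT proved;
N14 ∕ N19 ∕ N20 NOT discharged; K3⁷ OPEN, skeleton v5 untouched; counts UNMOVED.  One finite 𝕋⁴ programme at fixed ε; R4 closes only the CONDITIONAL finite-𝕋⁴ rung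
`BalabanLadder.UV` — NOT ℝ⁴, NOT OS, NOT the Yang–Mills mass gap (Clay), which is NOT proved by any of this.
-/

noncomputable section

open MeasureTheory ProbabilityTheory Finset

namespace YMDAG.N14.FibreOscillationOfDecoupling

open Summit.QuantumFields.BalabanUV.T4Continuum.NE1p.DressedMGFForm (tiltedMean)
open Summit.QuantumFields.BalabanUV.T4Continuum.NE1p.TiltedMeanInfluence (tiltedMean_prod_add influence_eq abs_influence_le abs_influence_le_of_centred)

variable {Ω S : Type*} {mΩ : MeasurableSpace Ω} {mS : MeasurableSpace S} {ι : Type*}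
  {ρ : Measure Ω} [IsFiniteMeasure ρ] {G : Ω → ℝ} {h : S → ℝ} {B a l₀ : ℝ}

/-- **UNDER A PRODUCT LAW THE TILTED MEAN OF A FIRST-FACTOR OBSERVABLE DOES NOT SEE THE SECOND FACTOR**: `tiltedMean (G ∘ fst) (ρ ⊗ κ) s = tiltedMean G ρ s` for finite
nonzero `ρ`, `κ` and bounded measurable `G` (NE1′'s `tiltedMean_prod_add` with the zero slot). [folklore] -/
theorem tiltedMean_prod_fst [NeZero ρ] (κ : Measure S) [IsFiniteMeasure κ] [NeZero κ] (hGm : Measurable G) (hG : ∀ ω, |G ω| ≤ B) (s : ℝ) :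
    tiltedMean (fun p : Ω × S => G p.1) (ρ.prod κ) s = tiltedMean G ρ s := by
  have hfun : (fun p : Ω × S => G p.1) = fun p : Ω × S => G p.1 + (fun _ : S => (0 : ℝ)) p.2 := funext fun p => by simp
  have h0 : tiltedMean (fun _ : S => (0 : ℝ)) κ s = 0 := by simp [tiltedMean]
  rw [hfun, tiltedMean_prod_add (a := 0) hGm hG measurable_const (fun _ => by simp) s, h0, add_zero]

/-- ★ **EXACT DECOUPLING ⇒ ZERO FIBRE OSCILLATION.**  On a fibre `fib` of fine classes whose pieces are products `ρ ⊗ κ τ` of ONE observable-region law `ρ ≠ 0` with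
class-dependent nonzero old-region laws `κ τ`, a first-factor observable has the SAME tilted mean on every class of the fibre: FILE 7's letter `hω` holds with `ω = 0`. [folklore] -/
theorem fibreOsc_zero_of_decoupled [NeZero ρ] (fib : Finset ι) (κ : ι → Measure S) (hκ : ∀ τ ∈ fib, IsFiniteMeasure (κ τ)) (hκ0 : ∀ τ ∈ fib, NeZero (κ τ))
    (hGm : Measurable G) (hG : ∀ ω, |G ω| ≤ B) :
    ∀ τ ∈ fib, ∀ τ' ∈ fib, ∀ s : ℝ,
      |tiltedMean (fun p : Ω × S => G p.1) (ρ.prod (κ τ)) s - tiltedMean (fun p : Ω × S => G p.1) (ρ.prod (κ τ')) s| ≤ 0 := by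
  intro τ hτ τ' hτ' s
  haveI := hκ τ hτ; haveI := hκ τ' hτ'; haveI := hκ0 τ hτ; haveI := hκ0 τ' hτ'
  rw [tiltedMean_prod_fst (κ τ) hGm hG s, tiltedMean_prod_fst (κ τ') hGm hG s, sub_self, abs_zero]

/-- ★ **ONE DECOUPLED SLOT OF AMPLITUDE `a` ⇒ FIBRE OSCILLATION `≤ 2a`.**  Same fibre, the observable now `G ⊕ h` with a slot contribution `h` on the old-region factor, `|h| ≤ a`:
the class-wise tilted means over the fibre differ by at most `2a` at every tilt (NE1′'s `abs_influence_le`: the common factor cancels EXACTLY, `influence_eq`). [folklore] -/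
theorem fibreOsc_le_of_slot [NeZero ρ] (fib : Finset ι) (κ : ι → Measure S) (hκ : ∀ τ ∈ fib, IsFiniteMeasure (κ τ)) (hκ0 : ∀ τ ∈ fib, NeZero (κ τ))
    (hGm : Measurable G) (hG : ∀ ω, |G ω| ≤ B) (hhm : Measurable h) (hh : ∀ x, |h x| ≤ a) (ha : 0 ≤ a) :
    ∀ τ ∈ fib, ∀ τ' ∈ fib, ∀ s : ℝ,
      |tiltedMean (fun p : Ω × S => G p.1 + h p.2) (ρ.prod (κ τ)) s - tiltedMean (fun p : Ω × S => G p.1 + h p.2) (ρ.prod (κ τ')) s| ≤ 2 * a := by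
  intro τ hτ τ' hτ' s
  haveI := hκ τ hτ; haveI := hκ τ' hτ'; haveI := hκ0 τ hτ; haveI := hκ0 τ' hτ'
  exact abs_influence_le (κA := κ τ') (κB := κ τ) hGm hG hhm hh ha s

/-- ★ **… AND `≤ 2a²·l₀` ON THE TILT WINDOW WHEN EVERY SLOT LAW CENTRES THE SLOT** (`∫ h dκ_τ = 0` for all `τ` in the fibre; NE1′'s `abs_influence_le_of_centred`: second order in
the amplitude — the mechanism of `Spine/NE1p/TiltedMeanInfluence` §3, by conjugation symmetry in the application). [folklore] -/
theorem fibreOsc_le_of_slot_centred [NeZero ρ] (fib : Finset ι) (κ : ι → Measure S) (hκ : ∀ τ ∈ fib, IsFiniteMeasure (κ τ)) (hκ0 : ∀ τ ∈ fib, NeZero (κ τ))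
    (hGm : Measurable G) (hG : ∀ ω, |G ω| ≤ B) (hhm : Measurable h) (hh : ∀ x, |h x| ≤ a) (hc : ∀ τ ∈ fib, ∫ x, h x ∂κ τ = 0) :
    ∀ τ ∈ fib, ∀ τ' ∈ fib, ∀ s : ℝ, |s| ≤ l₀ →
      |tiltedMean (fun p : Ω × S => G p.1 + h p.2) (ρ.prod (κ τ)) s - tiltedMean (fun p : Ω × S => G p.1 + h p.2) (ρ.prod (κ τ')) s| ≤ 2 * a ^ 2 * l₀ := by
  intro τ hτ τ' hτ' s hs
  haveI := hκ τ hτ; haveI := hκ τ' hτ'; haveI := hκ0 τ hτ; haveI := hκ0 τ' hτ'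
  refine (abs_influence_le_of_centred (κA := κ τ') (κB := κ τ) hGm hG hhm hh (hc τ' hτ') (hc τ hτ) s).trans ?_
  exact mul_le_mul_of_nonneg_left hs (by positivity)

end YMDAG.N14.FibreOscillationOfDecoupling

end
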